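import Summits.QuantumFields.YangMills.Theorems.LuscherReductionTwistedTraceScalingToronGain
import Summits.QuantumFields.YangMills.Theorems.LuscherReductionTwistedTraceScalingToronOrbit
import HarnessLib

/-!
# The VALLEY GAIN assembled: (i) the harmonic transfer eigenvalue factors ARE `√(π/b)·e^{−modeZPE(a/b)}`, so `log Λ = (n/2)log(π/b) − Σ modeZPE(aᵢ/b)`;
# (ii) a constant abelian background all of whose centre twists are `δ`-far from the vacuum orbit has charged-mode zero-point energy
# `≥ toronZPE(0) + gain1Slope·√2δ/(3L³)`
# (crux `TwistedTraceScaling` stmt-QuantumFields-20203 S-BASE, both COARSE lanes; design note `pub/ym-fleet/ym-luscher-20007-p1/COARSE-DESIGN.md` §12)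

* ★ `sqrt_pi_div_eq` : for `a ≥ 0`, `b > 0`, `c ≥ 0`, `c² = a² + 2ab`: `√(π/(a + b + c)) = √(π/b)·exp(−modeZPE(a/b))` — the per-mode factor of
  `TwoLattice.Stiff.stiff_groundState` / `Literature.…GaussianTransferKernelFrame` in zero-point-energy form; ★ `prod_sqrt_pi_div_eq` (the product over modes:
  `Πᵢ √(π/(aᵢ + b + cᵢ)) = √(π/b)^n · exp(−Σᵢ modeZPE(aᵢ/b))`).
* ★★★ `toronZPE_gain_of_valley` : `(∀ z, δ < orbitDist(τ_z V_θ)) → toronZPE L κ 0 0 + gain1Slope L κ·(√2δ/(3L³)) ≤ toronZPE L κ 0 (2θ)` — `…ToronOrbit`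
  (`exists_norm_gt_of_valley`) + `…ToronGain` (`toronZPE_zero_add_slope_mul_norm_le`).

HONEST FRAMING: assembly of landed bricks; the Gaussian step at `V_θ`, the twisted Fourier diagonalisation and the `k = 0` lower bound remain for C3;
femto rung R2b1 (brick for a stub of a child of a CONDITIONAL route); not a gap, not Clay.
-/

set_option autoImplicit false

noncomputable section

open Finset
open scoped BigOperators
open Literature.MathematicalPhysics.QuantumFieldTheory
open Literature.MathematicalPhysics.QuantumLattice

namespace Summit.QuantumFields.YangMills.Theorems.FemtoTransferGap.TwoLattice.Toron

open Summit.QuantumFields.YangMills.Theorems.FemtoTransferGap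

/-! ## §1 Harmonic transfer eigenvalue factors in zero-point-energy form -/

/-- `exp(−2·modeZPE y) = (1 + y + √(y² + 2y))⁻¹` for `y ≥ 0`. [cite: Wipf2021, §8.5.1 (8.56)–(8.58)] -/
theorem exp_neg_two_mul_modeZPE {y : ℝ} (hy : 0 ≤ y) : Real.exp (-(2 * modeZPE y)) = (1 + y + Real.sqrt (y ^ 2 + 2 * y))⁻¹ := by
  unfold modeZPE
  rw [mul_div_cancel₀ _ two_ne_zero, Real.exp_neg, Real.exp_arcosh (by linarith)]
  congr 2
  ring_nf

/-- ★ **Per-mode bridge**: for `a ≥ 0`, `b > 0`, `c ≥ 0` with `c² = a² + 2ab` (the Riccati datum of the harmonic transfer kernel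
`e^{−ax²}e^{−b(x−y)²}e^{−ay²}`), `√(π/(a + b + c)) = √(π/b)·exp(−modeZPE(a/b))`. [cite: Wipf2021, §8.5.1 (8.56)–(8.58)] -/
theorem sqrt_pi_div_eq {a b c : ℝ} (ha : 0 ≤ a) (hb : 0 < b) (hc : 0 ≤ c) (hcsq : c ^ 2 = a ^ 2 + 2 * a * b) :
    Real.sqrt (Real.pi / (a + b + c)) = Real.sqrt (Real.pi / b) * Real.exp (-modeZPE (a / b)) := by
  have hy : 0 ≤ a / b := div_nonneg ha hb.le
  -- `c = b·√((a/b)² + 2(a/b))`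
  have hc' : c = b * Real.sqrt ((a / b) ^ 2 + 2 * (a / b)) := by
    have h1 : (a / b) ^ 2 + 2 * (a / b) = c ^ 2 / b ^ 2 := by rw [hcsq]; field_simp
    rw [h1, Real.sqrt_div' _ (sq_nonneg b), Real.sqrt_sq hc, Real.sqrt_sq hb.le, mul_div_cancel₀ _ hb.ne']
  have hsum : a + b + c = b * (1 + a / b + Real.sqrt ((a / b) ^ 2 + 2 * (a / b))) := by
    rw [hc', mul_add, mul_add, mul_one, mul_div_cancel₀ _ hb.ne']; ring
  have hpos : 0 < 1 + a / b + Real.sqrt ((a / b) ^ 2 + 2 * (a / b)) := by positivity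
  have hexp : Real.exp (-modeZPE (a / b)) = Real.sqrt (Real.exp (-modeZPE (a / b)) ^ 2) :=
    (Real.sqrt_sq (Real.exp_pos _).le).symm
  rw [hexp, ← Real.sqrt_mul (div_nonneg Real.pi_pos.le hb.le)]
  congr 1
  rw [pow_two, ← Real.exp_add, show -modeZPE (a / b) + -modeZPE (a / b) = -(2 * modeZPE (a / b)) by ring,
    exp_neg_two_mul_modeZPE hy, hsum, div_mul_eq_div_div, div_eq_mul_inv (Real.pi / b)]

/-- ★ **Product bridge** (all normal modes): `Πᵢ √(π/(aᵢ + b + cᵢ)) = √(π/b)^{|ι|} · exp(−Σᵢ modeZPE(aᵢ/b))`. [cite: Wipf2021, §8.5.1 (8.56)–(8.58)] -/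
theorem prod_sqrt_pi_div_eq {ι : Type*} [Fintype ι] {a c : ι → ℝ} {b : ℝ} (ha : ∀ i, 0 ≤ a i) (hb : 0 < b) (hc : ∀ i, 0 ≤ c i)
    (hcsq : ∀ i, c i ^ 2 = a i ^ 2 + 2 * a i * b) :
    ∏ i, Real.sqrt (Real.pi / (a i + b + c i)) = Real.sqrt (Real.pi / b) ^ Fintype.card ι * Real.exp (-∑ i, modeZPE (a i / b)) := by
  rw [prod_congr rfl fun i _ => sqrt_pi_div_eq (ha i) hb (hc i) (hcsq i), prod_mul_distrib, prod_const, card_univ, ← Real.exp_sum, sum_neg_distrib]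

/-! ## §2 The valley gain of a twisted-far constant abelian background -/

/-- ★★★ **VALLEY GAIN**: if every centre twist of the constant abelian configuration `V_θ` is at orbit distance `> δ` from the vacuum, then its
charged-mode zero-point energy (adjoint phases `2θ`) exceeds the toron value by at least `gain1Slope L κ · √2δ/(3L³)` (`κ > 0`, `L ≥ 1`).
[cite: Luscher1983, §3] -/
theorem toronZPE_gain_of_valley (L : ℕ) [NeZero L] {κ : ℝ} (hκ : 0 < κ) (θ : Fin 3 → ℝ) {δ : ℝ}
    (h : ∀ z : Fin 3 → Bool, δ < orbitDist (TT.twist3 z (abelianCfg L θ))) :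
    toronZPE L κ 0 (fun _ => 0) + gain1Slope L κ * (Real.sqrt 2 * δ / (3 * (L : ℝ) ^ 3)) ≤ toronZPE L κ 0 (fun k => 2 * θ k) := by
  obtain ⟨k, hk⟩ := exists_norm_gt_of_valley θ h
  have h1 := toronZPE_zero_add_slope_mul_norm_le L hκ (fun k => 2 * θ k) k
  have h2 : gain1Slope L κ * (Real.sqrt 2 * δ / (3 * (L : ℝ) ^ 3)) ≤ gain1Slope L κ * ‖((2 * θ k : ℝ) : AddCircle (2 * Real.pi / L))‖ :=
    mul_le_mul_of_nonneg_left hk.le (gain1Slope_pos L hκ).le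
  linarith

/-- The same with the gain written against ANY of the three phases' distances (monotone restatement for consumers that track `max_k`). [folklore] -/
theorem toronZPE_zero_le_of_valley (L : ℕ) [NeZero L] {κ : ℝ} (hκ : 0 < κ) (θ : Fin 3 → ℝ) {δ : ℝ}
    (h : ∀ z : Fin 3 → Bool, δ < orbitDist (TT.twist3 z (abelianCfg L θ))) :
    toronZPE L κ 0 (fun _ => 0) ≤ toronZPE L κ 0 (fun k => 2 * θ k) - gain1Slope L κ * (Real.sqrt 2 * δ / (3 * (L : ℝ) ^ 3)) := by
  have := toronZPE_gain_of_valley L hκ θ h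
  linarith

end Summit.QuantumFields.YangMills.Theorems.FemtoTransferGap.TwoLattice.Toron

end
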